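import Summits.QuantumFields.BalabanUV.T4Continuum.Support.DirichletCornerCutoffH2

/-!
# T⁴ programme, spine node NE2 (U1a), sub-row Δ1 «NE2⁰-Dirichlet» — THE TRIVIAL CORNER-MASS BOUND (census item r0): the corner mass of
# a supported field is at most `2‖c‖⁻²` times its energy, so the region Dirichlet solution obeys the growth law `τ_k = 2γ′⁻¹·n_k²` (σ = 2)

NE2 formalisation swarm `b2b-balaban-t4-ne2-formalise-*`, LEAF PROVER 09 (gen 10), baseline brick for the re-entrant front (journal
`HOME/CLAIMS.log` 2026-08-21 l.23790 / l.25057; memo `t4/T4-EST-NE2-D1-CORNER.md` §3 (r0) «40 lines on request»).  The corner mass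
`cornerMass Ω z = Σ_{x corner} Σ_μ (|z(x+e_μ)|² + |z(x−e_μ)|²)` (`DirichletCornerRegularity`, p243392) of a field `z` supported in `Ω` is a
sum of squared BOUNDARY-CROSSING DIFFERENCES (`z` vanishes at the exterior corner site `x`), each of which is `‖c‖⁻²` times one term of
the energy `Σ_μ nsq (∂_μ z)`:
 * **`cornerMass_le_energy (hz : SuppIn N Ω z) (hc : c ≠ 0) : cornerMass Ω z ≤ 2(‖c‖²)⁻¹·Σ_μ nsq (sdiff N c μ *ᵥ z)`** (any finite
   torus, any `Ω`; the `2` counts the forward and backward crossings separately);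
 * **`cornerMass_solExt_le`**: for the zero-extended region Dirichlet solution at level `n ≥ 1`,
   `n⁴·cornerMass Ω (solExt f) ≤ 2γ′⁻¹·n²·‖f‖²` (gan24's `dirichlet_solExt_le`);
 * **`cornerGrowth_trivial_lev`** ∕ **`cornerGrowth_trivial_rpow`**: along the tower the displayed corner-mass binder `hτ` of this seat's
   ENDs is INHABITED by `τ k := 2γ′⁻¹·n_k²`, which obeys the growth law `τ k ≤ A·n_k^σ` of `DirichletCornerMassRates` with `A = 2γ′⁻¹`,
   **`σ = 2`** — the honest baseline of memo §3: at `σ = 2` the rate `θ_σ = √L ≥ 1` carries NO decay (decay needs `σ < 1`; Rellich would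
   give `σ = 1`, the expected truth at a right-angled re-entrant edge is `σ = 2/3`).  Nothing sharper is claimed.

HONEST FRAMING (T4-DAG p. 1).  [folklore] one Cauchy-free bookkeeping inequality; the bound is the TRIVIAL one and yields no decaying rate;
nothing about [B9]'s printed regions; `hinjK` ∕ W3 off boxes OPEN; Δ1 NOT closed; NE2 (U1a) NOT proved; spine PROVED 0/9 unchanged; NOT
infinite volume, NOT a mass gap, NOT the Clay problem.  HONEST DEPENDENCY: continuum YM on T⁴ ⇐ BetaPertH ∧ nine spine estimates (0/9
proved); BetaPertH ⇐ (D1) ∧ (D4) ∧ CAP+tail; G-an2-4 gates asym, D1 and NE2/3/4.  No `sorry`.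
-/

noncomputable section

open scoped BigOperators ComplexConjugate Matrix
open Finset

namespace Summit.QuantumFields.BalabanUV.T4Continuum.DirichletCornerMassEnergy

open Literature.MathematicalPhysics.QuantumFieldTheory.Balaban1983to89.B5Prop11Plancherel (Tor fine unitVec)
open Literature.MathematicalPhysics.QuantumFieldTheory.Balaban1983to89.B5Action121 (sdiff sdiff_mulVec)
open Literature.MathematicalPhysics.QuantumFieldTheory.Balaban1983to89.B5Prop11Lower (nsq nsq_nonneg)
open Literature.MathematicalPhysics.QuantumFieldTheory.Balaban1983to89.B5G183RateUnitTower (lev)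
open Summit.QuantumFields.BalabanUV.T4Continuum
open Summit.QuantumFields.BalabanUV.T4Continuum.ScalarAveragedPropagator (gammaPs gammaPs_pos)
open Summit.QuantumFields.BalabanUV.T4Continuum.BalabanAveragedTowerUnit (cast_lev' one_le_lev')
open Summit.QuantumFields.BalabanUV.T4Continuum.DirichletCornerRegularity (cornerSites cornerMass)
open Summit.QuantumFields.BalabanUV.T4Continuum.DirichletCornerCutoffH2 (sum_normSq_sdiff_shift sum_le_univ_of_nonneg)
open Summit.QuantumFields.BalabanUV.Beta.GAN24.DirichletBoxRegularity (SuppIn)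
open Summit.QuantumFields.BalabanUV.Beta.GAN24.DirichletBoxCompression (solExt solExt_apply_of_not dirichlet_solExt_le)
open Summit.QuantumFields.BalabanUV.Beta.GAN24.DirichletBoxTrace (blockReg)

variable {d : ℕ}

/-! ## §1 The corner mass of a supported field is energy -/

section Field

variable {N : Fin d → ℕ} [hN : ∀ μ, NeZero (N μ)] {Ω : Finset (Tor N)} {z : Tor N → ℂ}

/-- at an exterior site of the support, `|z(x+e_μ)|² + |z(x−e_μ)|² = ‖c‖⁻²(|(∂_μz)(x)|² + |(∂_μz)(x−e_μ)|²)`. [folklore] -/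
theorem normSq_nb_eq_of_zero {x : Tor N} (h0 : z x = 0) {c : ℂ} (hc : c ≠ 0) (μ : Fin d) :
    ‖z (x + unitVec N μ)‖ ^ 2 + ‖z (x - unitVec N μ)‖ ^ 2
      = (‖c‖ ^ 2)⁻¹ * (‖(sdiff N c μ *ᵥ z) x‖ ^ 2 + ‖(sdiff N c μ *ᵥ z) (x - unitVec N μ)‖ ^ 2) := by
  have hc2 : ‖c‖ ^ 2 ≠ 0 := pow_ne_zero 2 (norm_ne_zero_iff.mpr hc)
  rw [sdiff_mulVec, sdiff_mulVec, sub_add_cancel, h0, sub_zero, zero_sub, norm_mul, norm_mul, norm_neg, mul_pow, mul_pow,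
    ← mul_add, ← mul_assoc, inv_mul_cancel₀ hc2, one_mul]

/-- **THE CORNER MASS OF A FIELD SUPPORTED IN `Ω` IS AT MOST `2‖c‖⁻²` TIMES ITS ENERGY**. [folklore] -/
theorem cornerMass_le_energy (hz : SuppIn N Ω z) {c : ℂ} (hc : c ≠ 0) :
    cornerMass Ω z ≤ 2 * (‖c‖ ^ 2)⁻¹ * ∑ μ, nsq (sdiff N c μ *ᵥ z) := by
  classical
  have hpt : ∀ x ∈ cornerSites Ω, ∑ μ, (‖z (x + unitVec N μ)‖ ^ 2 + ‖z (x - unitVec N μ)‖ ^ 2)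
      = ∑ μ, (‖c‖ ^ 2)⁻¹ * (‖(sdiff N c μ *ᵥ z) x‖ ^ 2 + ‖(sdiff N c μ *ᵥ z) (x - unitVec N μ)‖ ^ 2) := by
    intro x hx
    have hx' : x ∉ Ω := Finset.mem_compl.mp (Finset.mem_filter.mp hx).1
    exact Finset.sum_congr rfl fun μ _ => normSq_nb_eq_of_zero (hz x hx') hc μ
  have hF : ∀ x, 0 ≤ ∑ μ, (‖c‖ ^ 2)⁻¹ * (‖(sdiff N c μ *ᵥ z) x‖ ^ 2 + ‖(sdiff N c μ *ᵥ z) (x - unitVec N μ)‖ ^ 2) :=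
    fun x => sum_nonneg fun μ _ => by positivity
  calc cornerMass Ω z
      = ∑ x ∈ cornerSites Ω, ∑ μ, (‖c‖ ^ 2)⁻¹ * (‖(sdiff N c μ *ᵥ z) x‖ ^ 2 + ‖(sdiff N c μ *ᵥ z) (x - unitVec N μ)‖ ^ 2) := by
        unfold cornerMass; exact Finset.sum_congr rfl hpt
    _ ≤ ∑ x, ∑ μ, (‖c‖ ^ 2)⁻¹ * (‖(sdiff N c μ *ᵥ z) x‖ ^ 2 + ‖(sdiff N c μ *ᵥ z) (x - unitVec N μ)‖ ^ 2) :=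
        sum_le_univ_of_nonneg (cornerSites Ω) hF
    _ = (‖c‖ ^ 2)⁻¹ * ∑ μ, (∑ x, ‖(sdiff N c μ *ᵥ z) x‖ ^ 2 + ∑ x, ‖(sdiff N c μ *ᵥ z) (x - unitVec N μ)‖ ^ 2) := by
        rw [Finset.sum_comm, Finset.mul_sum]
        refine Finset.sum_congr rfl fun μ _ => ?_
        rw [← Finset.sum_add_distrib, Finset.mul_sum]
    _ = 2 * (‖c‖ ^ 2)⁻¹ * ∑ μ, nsq (sdiff N c μ *ᵥ z) := by
        have e : ∀ μ, (∑ x, ‖(sdiff N c μ *ᵥ z) x‖ ^ 2 + ∑ x, ‖(sdiff N c μ *ᵥ z) (x - unitVec N μ)‖ ^ 2)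
            = 2 * nsq (sdiff N c μ *ᵥ z) := fun μ => by
          rw [sum_normSq_sdiff_shift, nsq, two_mul]
        rw [Finset.sum_congr rfl fun μ _ => e μ, ← Finset.mul_sum]
        ring

end Field

/-! ## §2 The region Dirichlet solution: `n⁴·cornerMass ≤ 2γ′⁻¹·n²·‖f‖²` -/

section Region

variable (n : ℕ) [NeZero n] (M : Fin d → ℕ) [hM : ∀ μ, NeZero (M μ)] (S : Tor M → Prop) [DecidablePred S] {a' : ℝ}

/-- **THE TRIVIAL CORNER-MASS BOUND FOR THE ZERO-EXTENDED REGION DIRICHLET SOLUTION** (`0 < a′`, any union of unit blocks, any decidable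
spelling `p` of `Ω = blockReg n S`): `n⁴·cornerMass Ω (solExt f) ≤ 2γ′⁻¹·n²·‖f‖²`. [folklore] -/
theorem cornerMass_solExt_le (ha' : 0 < a') (p : Tor (fine n M) → Prop) [DecidablePred p] (hp : ∀ x, p x ↔ blockReg n M S x)
    (f : {x // p x} → ℂ) :
    (n : ℝ) ^ 4 * cornerMass (univ.filter (blockReg n M S)) (solExt n M a' p f) ≤ 2 * (gammaPs d a')⁻¹ * (n : ℝ) ^ 2 * nsq f := by
  have hn : (n : ℂ) ≠ 0 := Nat.cast_ne_zero.mpr (NeZero.ne n)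
  have hsupp : SuppIn (fine n M) (univ.filter (blockReg n M S)) (solExt n M a' p f) := by
    intro x hx
    rw [Finset.mem_filter] at hx
    exact solExt_apply_of_not n M a' p f (fun h => hx ⟨Finset.mem_univ _, (hp x).mp h⟩)
  have h1 := cornerMass_le_energy hsupp hn
  have h2 : ∑ μ, nsq (sdiff (fine n M) (n : ℂ) μ *ᵥ solExt n M a' p f) ≤ (gammaPs d a')⁻¹ * nsq f := dirichlet_solExt_le n M a' _ ha' f
  have hnn : ‖(n : ℂ)‖ ^ 2 = (n : ℝ) ^ 2 := by rw [Complex.norm_natCast]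
  rw [hnn] at h1
  have hn2 : (0 : ℝ) < (n : ℝ) ^ 2 := by
    have : (0 : ℝ) < n := by exact_mod_cast Nat.pos_of_ne_zero (NeZero.ne n)
    positivity
  have h3 : cornerMass (univ.filter (blockReg n M S)) (solExt n M a' p f) ≤ 2 * ((n : ℝ) ^ 2)⁻¹ * ((gammaPs d a')⁻¹ * nsq f) :=
    h1.trans (mul_le_mul_of_nonneg_left h2 (by positivity))
  have h4 : (n : ℝ) ^ 2 * ((n : ℝ) ^ 2)⁻¹ = 1 := mul_inv_cancel₀ hn2.ne'
  calc (n : ℝ) ^ 4 * cornerMass (univ.filter (blockReg n M S)) (solExt n M a' p f)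
      ≤ (n : ℝ) ^ 4 * (2 * ((n : ℝ) ^ 2)⁻¹ * ((gammaPs d a')⁻¹ * nsq f)) := mul_le_mul_of_nonneg_left h3 (by positivity)
    _ = ((n : ℝ) ^ 2 * ((n : ℝ) ^ 2)⁻¹) * (2 * (gammaPs d a')⁻¹ * (n : ℝ) ^ 2 * nsq f) := by ring
    _ = 2 * (gammaPs d a')⁻¹ * (n : ℝ) ^ 2 * nsq f := by rw [h4, one_mul]

end Region

/-! ## §3 Along the tower: the displayed binder `hτ` inhabited with `τ_k = 2γ′⁻¹·n_k²`, growth exponent `σ = 2` -/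

section Tower

variable (L : ℕ) [NeZero L] (M : Fin d → ℕ) [hM : ∀ μ, NeZero (M μ)] (S : Tor M → Prop) [DecidablePred S] {a' : ℝ}

/-- **THE ENDs' CORNER-MASS BINDER `hτ` INHABITED TRIVIALLY**: `∀ k f, n_k⁴·cornerMass (solExt f) ≤ τ k·‖f‖²` with
`τ k := 2γ′⁻¹·n_k²`. [folklore] -/
theorem cornerGrowth_trivial_lev (ha' : 0 < a') (k : ℕ) (f : {x // blockReg (lev L k) M S x} → ℂ) :
    ((lev L k : ℕ) : ℝ) ^ 4 * cornerMass (univ.filter (blockReg (lev L k) M S)) (solExt (lev L k) M a' (blockReg (lev L k) M S) f)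
      ≤ (2 * (gammaPs d a')⁻¹ * ((lev L k : ℕ) : ℝ) ^ 2) * nsq f := by
  have h := cornerMass_solExt_le (lev L k) M S ha' (blockReg (lev L k) M S) (fun _ => Iff.rfl) f
  linarith

omit [NeZero L] in
/-- `0 ≤ τ k` for the trivial `τ`. [folklore] -/
theorem cornerGrowth_trivial_nonneg (a' : ℝ) (k : ℕ) : 0 ≤ 2 * (gammaPs d a')⁻¹ * ((lev L k : ℕ) : ℝ) ^ 2 := by
  have := (gammaPs_pos (d := d) (a' := a')).1
  positivity

omit [NeZero L] in
/-- **… AND IT OBEYS THE GROWTH LAW WITH `A = 2γ′⁻¹`, `σ = 2`** (`DirichletCornerMassRates`' `hgr`, rpow form; equality in fact): the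
honest baseline — at `σ = 2` the rate `θ_σ = √L` does not decay. [folklore] -/
theorem cornerGrowth_trivial_rpow (a' : ℝ) (k : ℕ) :
    2 * (gammaPs d a')⁻¹ * ((lev L k : ℕ) : ℝ) ^ 2 ≤ 2 * (gammaPs d a')⁻¹ * ((lev L k : ℕ) : ℝ) ^ (2 : ℝ) := by
  rw [Real.rpow_two]

end Tower

end Summit.QuantumFields.BalabanUV.T4Continuum.DirichletCornerMassEnergy

end
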